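import Summits.PneNP.PneNP.Theses.PrimalityPlaces
import Literature.Computability.MetaComplexity.ResolutionStepLists

/-!
# Corner primes I — the zero-cascade cell and the route's encoding, named
(negative-side support for crux `stmt-PneNP-16923`,
`PrimalityPlaces.ResolutionCannotProvePrimality`)

First of three files (`CornerPrimesCells`, `CornerPrimesRows`, `CornerPrimes`) constructing, for
`n ≥ 3` and every `p` in the corner window `[4^(n-1), 4^(n-1) + 2^(n-1))` with bit `0` set, a
resolution refutation of the route's `balancedCNF n p` with `O(n²)` lines, and deducing
`CornerPrimesIO → ¬ ResolutionCannotProvePrimality` (see `CornerPrimes` for the statement,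
the discussion and the references).  This file:

* `cellL_stepList` — the ZERO-CASCADE RULE as a content-addressed step list
  (`ResolutionStepLists.StepList`): from the route's full-adder clauses `xorCl s a b c`,
  `majCl m a b c` and the units `¬s`, `¬m`, twelve weakened resolution steps derive `¬a`, `¬b`,
  `¬c` (a full adder with sum `0` and carry `0` has all inputs `0`); `topCellL_stepList` — the
  corner cell (carry `0`, partial product `1` ⇒ the other two inputs `0`).  Steps only need SUBSET
  witnesses, so no distinctness of variable indices is used anywhere.
* `bal n p` — the route's inline let-chain (`X, Y, PP, S, C, Z0, acc, cin, andCl, xorCl, majCl,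
  mulCNF, outCl, balancedCNF`) with names; `resolutionCannotProvePrimality_iff` identifies the crux
  with the same statement over `bal` by `Iff.rfl`.
* membership lemmas for the axioms of `bal n p` and evaluation lemmas for the `if`s of `accV`.

References: J. Krajíček, *Proof Complexity* (CUP 2019) §5.1 (resolution with weakening);
J. Krajíček, P. Pudlák, Inform. Comput. 140 (1998) §4 (the tautologies `σ_p`).
-/

set_option linter.dupNamespace false -- `Summit.PneNP.PneNP.…`: summit = sub-problem (D-0017)

open Literature.Computability.Complexity Literature.Computability.MetaComplexity

namespace Summit.PneNP.PneNP.Theorems.ResolutionCannotProvePrimality.Negative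

/-! ### Generic one-step helpers -/

/-- One `DerivStep` by resolution on `v` followed by weakening, with the two subset witnesses
phrased as `D ⊆ insert (v,⊤) C`, `E ⊆ insert (v,⊥) C`. [Krajíček 2019, §5.1] -/
theorem step_res {A : Set (Finset (Literal ℕ))} {C D E : Finset (Literal ℕ)} (v : ℕ)
    (hD : D ∈ A) (hE : E ∈ A) (hvD : (v, true) ∈ D) (hvE : (v, false) ∈ E)
    (h₁ : D ⊆ insert (v, true) C) (h₂ : E ⊆ insert (v, false) C) : DerivStep A C :=
  DerivStep.of_res hD hE hvD hvE (Finset.subset_insert_iff.1 h₁) (Finset.subset_insert_iff.1 h₂)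

/-- One `DerivStep` copying an available clause (up to a propositional equality). -/
theorem step_eq {A : Set (Finset (Literal ℕ))} {C D : Finset (Literal ℕ)} (hD : D ∈ A)
    (h : D = C) : DerivStep A C :=
  DerivStep.of_mem hD h.le

/-! ### The generic full-adder cell: from `¬s`, `¬m` derive `¬a`, `¬b`, `¬c` -/

/-- the route's eight clauses for `s ↔ a ⊕ b ⊕ c`. -/
def xorCl (s a b c : ℕ) : CNF ℕ :=
  [[(a, false), (b, true), (c, true), (s, true)], [(a, true), (b, false), (c, true), (s, true)],
    [(a, true), (b, true), (c, false), (s, true)], [(a, true), (b, true), (c, true), (s, false)],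
    [(a, false), (b, false), (c, false), (s, true)],
    [(a, false), (b, false), (c, true), (s, false)],
    [(a, false), (b, true), (c, false), (s, false)],
    [(a, true), (b, false), (c, false), (s, false)]]

/-- the route's six clauses for `m ↔ MAJ(a,b,c)`. -/
def majCl (m a b c : ℕ) : CNF ℕ :=
  [[(m, false), (a, true), (b, true)], [(m, false), (a, true), (c, true)],
    [(m, false), (b, true), (c, true)], [(m, true), (a, false), (b, false)],
    [(m, true), (a, false), (c, false)], [(m, true), (b, false), (c, false)]]

/-- the clauses derived at a generic cell, in order; `a'`, `c'` are renamed copies of `a`, `c`. -/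
def cellL (a b c a' c' : ℕ) : List (Finset (Literal ℕ)) :=
  [ {(a, false), (b, false)}, {(a, false), (c, false)}, {(b, false), (c, false)},
    {(a, false), (b, true), (c, true)}, {(a, false), (c, true)}, {(a, false)},
    {(a, true), (b, false), (c, true)}, {(b, false), (c, true)}, {(b, false)},
    {(a, true), (b, true), (c, false)}, {(b, true), (c, false)}, {(c, false)},
    {(a', false)}, {(c', false)} ]

/-- **The zero-cascade rule.** From the full-adder clauses on `(s,a,b,c,m)` and the units `¬s`,
`¬m`, the list `cellL a b c a' c'` (ending in the units `¬a`, `¬b`, `¬c` and renamed copies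
`¬a'`, `¬c'`) is a step list. -/
theorem cellL_stepList {A : Set (Finset (Literal ℕ))} {s a b c m a' c' : ℕ}
    (hxor : ∀ cl ∈ xorCl s a b c, cl.toFinset ∈ A) (hmaj : ∀ cl ∈ majCl m a b c, cl.toFinset ∈ A)
    (hs : ({(s, false)} : Finset (Literal ℕ)) ∈ A) (hm : ({(m, false)} : Finset (Literal ℕ)) ∈ A)
    (ha : a' = a) (hc : c' = c) : StepList A (cellL a b c a' c') := by
  have x1 : ({(a, false), (b, true), (c, true), (s, true)} : Finset (Literal ℕ)) ∈ A := by
    simpa using hxor [(a, false), (b, true), (c, true), (s, true)] (by simp [xorCl])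
  have x2 : ({(a, true), (b, false), (c, true), (s, true)} : Finset (Literal ℕ)) ∈ A := by
    simpa using hxor [(a, true), (b, false), (c, true), (s, true)] (by simp [xorCl])
  have x3 : ({(a, true), (b, true), (c, false), (s, true)} : Finset (Literal ℕ)) ∈ A := by
    simpa using hxor [(a, true), (b, true), (c, false), (s, true)] (by simp [xorCl])
  have m4 : ({(m, true), (a, false), (b, false)} : Finset (Literal ℕ)) ∈ A := by
    simpa using hmaj [(m, true), (a, false), (b, false)] (by simp [majCl])
  have m5 : ({(m, true), (a, false), (c, false)} : Finset (Literal ℕ)) ∈ A := by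
    simpa using hmaj [(m, true), (a, false), (c, false)] (by simp [majCl])
  have m6 : ({(m, true), (b, false), (c, false)} : Finset (Literal ℕ)) ∈ A := by
    simpa using hmaj [(m, true), (b, false), (c, false)] (by simp [majCl])
  unfold cellL
  refine stepList_cons.2 ⟨step_res m
    m4 hm (by simp) (by simp)
    (by simp) (by simp), ?_⟩
  refine stepList_cons.2 ⟨step_res m
    (D := {(m, true), (a, false), (c, false)})
    (E := {(m, false)})
    (by simp [m5]) (by simp [hm]) (by simp) (by simp)
    (by simp) (by simp), ?_⟩
  refine stepList_cons.2 ⟨step_res m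
    (D := {(m, true), (b, false), (c, false)})
    (E := {(m, false)})
    (by simp [m6]) (by simp [hm]) (by simp) (by simp)
    (by simp) (by simp), ?_⟩
  refine stepList_cons.2 ⟨step_res s
    (D := {(a, false), (b, true), (c, true), (s, true)})
    (E := {(s, false)})
    (by simp [x1]) (by simp [hs]) (by simp) (by simp)
    (by simp [Finset.insert_subset_iff]) (by simp), ?_⟩
  refine stepList_cons.2 ⟨step_res b
    (D := {(a, false), (b, true), (c, true)})
    (E := {(a, false), (b, false)})
    (by simp) (by simp) (by simp) (by simp)
    (by simp [Finset.insert_subset_iff]) (by simp [Finset.insert_subset_iff]), ?_⟩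
  refine stepList_cons.2 ⟨step_res c
    (D := {(a, false), (c, true)})
    (E := {(a, false), (c, false)})
    (by simp) (by simp) (by simp) (by simp)
    (by simp [Finset.insert_subset_iff]) (by simp [Finset.insert_subset_iff]), ?_⟩
  refine stepList_cons.2 ⟨step_res s
    (D := {(a, true), (b, false), (c, true), (s, true)})
    (E := {(s, false)})
    (by simp [x2]) (by simp [hs]) (by simp) (by simp)
    (by simp [Finset.insert_subset_iff]) (by simp), ?_⟩
  refine stepList_cons.2 ⟨step_res a
    (D := {(a, true), (b, false), (c, true)})
    (E := {(a, false)})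
    (by simp) (by simp) (by simp) (by simp)
    (by simp) (by simp), ?_⟩
  refine stepList_cons.2 ⟨step_res c
    (D := {(b, false), (c, true)})
    (E := {(b, false), (c, false)})
    (by simp) (by simp) (by simp) (by simp)
    (by simp [Finset.insert_subset_iff]) (by simp [Finset.insert_subset_iff]), ?_⟩
  refine stepList_cons.2 ⟨step_res s
    (D := {(a, true), (b, true), (c, false), (s, true)})
    (E := {(s, false)})
    (by simp [x3]) (by simp [hs]) (by simp) (by simp)
    (by simp [Finset.insert_subset_iff]) (by simp), ?_⟩
  refine stepList_cons.2 ⟨step_res a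
    (D := {(a, true), (b, true), (c, false)})
    (E := {(a, false)})
    (by simp) (by simp) (by simp) (by simp)
    (by simp) (by simp), ?_⟩
  refine stepList_cons.2 ⟨step_res b
    (D := {(b, true), (c, false)})
    (E := {(b, false)})
    (by simp) (by simp) (by simp) (by simp)
    (by simp) (by simp), ?_⟩
  refine stepList_cons.2 ⟨step_eq (D := {(a, false)}) (by simp) (by rw [ha]), ?_⟩
  refine stepList_cons.2 ⟨step_eq (D := {(c, false)}) (by simp) (by rw [hc]), ?_⟩
  exact stepList_nil _


/-! ### The special top cell: from `¬m` and `b` derive `¬a`, `¬c` -/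

/-- the clauses derived at the corner cell (column `2n-2`): from `¬m` and `b` get `¬a`, `¬c`. -/
def topCellL (a b c a' c' : ℕ) : List (Finset (Literal ℕ)) :=
  [ {(a, false), (b, false)}, {(a, false)}, {(b, false), (c, false)}, {(c, false)},
    {(a', false)}, {(c', false)} ]

/-- The corner cell is a step list. -/
theorem topCellL_stepList {A : Set (Finset (Literal ℕ))} {a b c m a' c' : ℕ}
    (hmaj : ∀ cl ∈ majCl m a b c, cl.toFinset ∈ A)
    (hm : ({(m, false)} : Finset (Literal ℕ)) ∈ A) (hb : ({(b, true)} : Finset (Literal ℕ)) ∈ A)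
    (ha : a' = a) (hc : c' = c) : StepList A (topCellL a b c a' c') := by
  have m4 : ({(m, true), (a, false), (b, false)} : Finset (Literal ℕ)) ∈ A := by
    simpa using hmaj [(m, true), (a, false), (b, false)] (by simp [majCl])
  have m6 : ({(m, true), (b, false), (c, false)} : Finset (Literal ℕ)) ∈ A := by
    simpa using hmaj [(m, true), (b, false), (c, false)] (by simp [majCl])
  unfold topCellL
  refine stepList_cons.2 ⟨step_res m
    m4 hm (by simp) (by simp)
    (by simp) (by simp), ?_⟩
  refine stepList_cons.2 ⟨step_res b
    (D := {(b, true)})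
    (E := {(a, false), (b, false)})
    (by simp [hb]) (by simp) (by simp) (by simp)
    (by simp) (by simp [Finset.insert_subset_iff]), ?_⟩
  refine stepList_cons.2 ⟨step_res m
    (D := {(m, true), (b, false), (c, false)})
    (E := {(m, false)})
    (by simp [m6]) (by simp [hm]) (by simp) (by simp)
    (by simp) (by simp), ?_⟩
  refine stepList_cons.2 ⟨step_res b
    (D := {(b, true)})
    (E := {(b, false), (c, false)})
    (by simp [hb]) (by simp) (by simp) (by simp)
    (by simp) (by simp), ?_⟩
  refine stepList_cons.2 ⟨step_eq (D := {(a, false)}) (by simp) (by rw [ha]), ?_⟩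
  refine stepList_cons.2 ⟨step_eq (D := {(c, false)}) (by simp) (by rw [hc]), ?_⟩
  exact stepList_nil _

/-! ### The route's inline encoding, with names -/

/-- variable `x_i`. -/
def XV (i : ℕ) : ℕ := i
/-- variable `y_j`. -/
def YV (n j : ℕ) : ℕ := n + j
/-- partial product `x_i ∧ y_j`. -/
def PPV (n i j : ℕ) : ℕ := 2 * n + i * n + j
/-- sum bit `k` of row `i`. -/
def SV (n i k : ℕ) : ℕ := 2 * n + n * n + i * (2 * n) + k
/-- carry `j` of row `i`. -/
def CV (n i j : ℕ) : ℕ := 2 * n + 3 * (n * n) + i * (n + 1) + j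
/-- the constant-zero variable. -/
def Z0V (n : ℕ) : ℕ := 3 * n + 4 * (n * n)
/-- bit `k` of the accumulated sum after row `i`. -/
def accV (n i k : ℕ) : ℕ :=
  if i = 0 then (if k < n then PPV n 0 k else Z0V n) else if k = 0 then PPV n 0 0 else
    if k < i then SV n k k else if k < n + i then SV n i k else CV n i n
/-- carry into position `j` of row `i`. -/
def cinV (n i j : ℕ) : ℕ := if j = 0 then Z0V n else CV n i j
/-- `z ↔ a ∧ b`. -/
def andCl (z a b : ℕ) : CNF ℕ :=
  [[(z, false), (a, true)], [(z, false), (b, true)], [(z, true), (a, false), (b, false)]]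
/-- the multiplier array. -/
def mulCNF (n : ℕ) : CNF ℕ :=
  [[(Z0V n, false)]] ++
    ((List.range n).flatMap fun i => (List.range n).flatMap fun j =>
      andCl (PPV n i j) (XV i) (YV n j)) ++
    ((List.range n).flatMap fun i => if i = 0 then [] else (List.range n).flatMap fun j =>
      xorCl (SV n i (i + j)) (accV n (i - 1) (i + j)) (PPV n i j) (cinV n i j) ++
        majCl (CV n i (j + 1)) (accV n (i - 1) (i + j)) (PPV n i j) (cinV n i j))
/-- the output unit clauses `Z k = bit_k(p)`. -/
def outCl (n p : ℕ) : CNF ℕ :=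
  (List.range (2 * n)).map fun k => [(accV n (n - 1) k, Nat.testBit p k)]
/-- `balancedCNF n p` of the route, verbatim. -/
def bal (n p : ℕ) : CNF ℕ :=
  mulCNF n ++ outCl n p ++ [[(XV (n - 1), true)], [(YV n (n - 1), true)]]

/-- The crux unfolds to a statement about `bal`. -/
theorem resolutionCannotProvePrimality_iff :
    Theses.PrimalityPlaces.ResolutionCannotProvePrimality ↔
      ∃ ε : ℝ, 0 < ε ∧ ∃ N : ℕ, ∀ n ≥ N, ∀ p : ℕ, p.Prime → 4 ^ (n - 1) ≤ p → p < 4 ^ n →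
        ∀ π : List (ResLine ℕ), IsResRefutation (bal n p) π →
          (2 : ℝ) ^ ((n : ℝ) ^ ε) ≤ (π.length : ℝ) :=
  Iff.rfl


/-! ### Axioms of `bal n p`: membership lemmas -/

section mem
variable {n p : ℕ}

/-- clauses of `bal n p` are axioms of `clauseSet (bal n p)`. -/
theorem ax {cl : Clause ℕ} (h : cl ∈ bal n p) : cl.toFinset ∈ clauseSet (bal n p) :=
  mem_clauseSet_iff.2 ⟨cl, h, rfl⟩

/-- the zero unit. -/
theorem z0_mem : [(Z0V n, false)] ∈ bal n p := by
  simp [bal, mulCNF]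

/-- the AND-gate clauses. -/
theorem and_mem {i j : ℕ} (hi : i < n) (hj : j < n) {cl : Clause ℕ}
    (h : cl ∈ andCl (PPV n i j) (XV i) (YV n j)) : cl ∈ bal n p := by
  refine List.mem_append.2 (Or.inl (List.mem_append.2 (Or.inl ?_)))
  refine List.mem_append.2 (Or.inl (List.mem_append.2 (Or.inr ?_)))
  exact List.mem_flatMap.2 ⟨i, List.mem_range.2 hi, List.mem_flatMap.2 ⟨j, List.mem_range.2 hj, h⟩⟩

/-- the XOR3 clauses of row `i ≥ 1`, position `j`. -/
theorem xor_mem {i j : ℕ} (hi : i < n) (hi0 : i ≠ 0) (hj : j < n) {cl : Clause ℕ}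
    (h : cl ∈ xorCl (SV n i (i + j)) (accV n (i - 1) (i + j)) (PPV n i j) (cinV n i j)) :
    cl ∈ bal n p := by
  refine List.mem_append.2 (Or.inl (List.mem_append.2 (Or.inl ?_)))
  refine List.mem_append.2 (Or.inr ?_)
  refine List.mem_flatMap.2 ⟨i, List.mem_range.2 hi, ?_⟩
  rw [if_neg hi0]
  exact List.mem_flatMap.2 ⟨j, List.mem_range.2 hj, List.mem_append.2 (Or.inl h)⟩

/-- the MAJ clauses of row `i ≥ 1`, position `j`. -/
theorem maj_mem {i j : ℕ} (hi : i < n) (hi0 : i ≠ 0) (hj : j < n) {cl : Clause ℕ}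
    (h : cl ∈ majCl (CV n i (j + 1)) (accV n (i - 1) (i + j)) (PPV n i j) (cinV n i j)) :
    cl ∈ bal n p := by
  refine List.mem_append.2 (Or.inl (List.mem_append.2 (Or.inl ?_)))
  refine List.mem_append.2 (Or.inr ?_)
  refine List.mem_flatMap.2 ⟨i, List.mem_range.2 hi, ?_⟩
  rw [if_neg hi0]
  exact List.mem_flatMap.2 ⟨j, List.mem_range.2 hj, List.mem_append.2 (Or.inr h)⟩

/-- the output units. -/
theorem out_mem {k : ℕ} (hk : k < 2 * n) : [(accV n (n - 1) k, Nat.testBit p k)] ∈ bal n p := by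
  refine List.mem_append.2 (Or.inl (List.mem_append.2 (Or.inr ?_)))
  exact List.mem_map.2 ⟨k, List.mem_range.2 hk, rfl⟩

/-- the balance unit `x_{n-1} = 1`. -/
theorem xunit_mem : [(XV (n - 1), true)] ∈ bal n p := by
  simp [bal]

/-- the balance unit `y_{n-1} = 1`. -/
theorem yunit_mem : [(YV n (n - 1), true)] ∈ bal n p := by
  simp [bal]

end mem

/-! ### Evaluating the `if`s of `accV` / `cinV` -/

section eval
variable {n : ℕ}

/-- output bit `n-1+j` of the top row is the sum bit `S (n-1) (n-1+j)`. -/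
theorem accV_top (hn : 2 ≤ n) {j : ℕ} (hj : j < n) :
    accV n (n - 1) (n - 1 + j) = SV n (n - 1) (n - 1 + j) := by
  unfold accV
  rw [if_neg (by omega), if_neg (by omega), if_neg (by omega), if_pos (by omega)]

/-- output bit `0` is `PP 0 0`. -/
theorem accV_zero (hn : 2 ≤ n) : accV n (n - 1) 0 = PPV n 0 0 := by
  unfold accV
  rw [if_neg (by omega), if_pos rfl]

/-- output bit `2n-1` is the top carry of the top row. -/
theorem accV_topcarry (hn : 2 ≤ n) : accV n (n - 1) (2 * n - 1) = CV n (n - 1) (n - 1 + 1) := by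
  unfold accV
  rw [if_neg (by omega), if_neg (by omega), if_neg (by omega), if_neg (by omega)]
  congr 1; omega

/-- an `a` input equal to the top carry of the row below. -/
theorem accV_carry {r k : ℕ} (hr : 1 ≤ r) (hk : k = r + n) :
    accV n r k = CV n r n := by
  unfold accV
  rw [if_neg (by omega), if_neg (by omega), if_neg (by omega), if_neg (by omega)]

/-- an `a` input equal to a sum bit of the row below. -/
theorem accV_sum {r k : ℕ} (hr : 1 ≤ r) (hk1 : r ≤ k) (hk2 : k < n + r) :
    accV n r k = SV n r k := by
  unfold accV
  rw [if_neg (by omega), if_neg (by omega), if_neg (by omega), if_pos hk2]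

/-- an `a` input of row `1` equal to a partial product of row `0`. -/
theorem accV_row0 {k : ℕ} (hk : k < n) : accV n 0 k = PPV n 0 k := by
  unfold accV
  rw [if_pos rfl, if_pos hk]

/-- the `a` input of the top cell of row `1` is the zero variable. -/
theorem accV_row0_top {k : ℕ} (hk : n ≤ k) : accV n 0 k = Z0V n := by
  unfold accV
  rw [if_pos rfl, if_neg (by omega)]

/-- a carry-in at a positive position is a carry variable. -/
theorem cinV_pos {r j : ℕ} (hj : j ≠ 0) : cinV n r j = CV n r j := by
  unfold cinV; rw [if_neg hj]

end eval

end Summit.PneNP.PneNP.Theorems.ResolutionCannotProvePrimality.Negative
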